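/-
Copyright: the b2b-balaban T⁴-continuum CRUX team, row NE7b OWNER lineage `t4-ne7b-p1` (gen 122). Project licence.
-/
import Summits.QuantumFields.BalabanUV.T4Continuum.Spine.NE7b.SupTorusBlockL1Profile
import Summits.QuantumFields.BalabanUV.T4Continuum.Spine.NE7b.SupTorusPointwiseProfile

/-!
# POINTWISE EXPONENTIAL DECAY OF `H_V⁻¹f` ON THE ROAD'S OWN CLASS `−λ ≤ V ≤ Λ` (EITHER SIGN, NO MAXIMUM PRINCIPLE), `d ≥ 3`:
# `|f| ≤ M·e^{−γρ_s(bt ·, y₀)}` ⟹ `e^{δρ_s(bt x, y₀)}·|u x| ≤ C·M` at EVERY site, `(C, δ)` from `(d, a, λ, Λ, γ)` and the interior constant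
# `C(d)` only, every mesh, every volume — interior elliptic regularity (`Beta.PoissonInterior.interior_estimate`) on the periodic lift at the
# radius `θ(n+1)` with EXPONENTIAL WEIGHTS: (153)'s decaying block-`ℓ¹` letter, (149)'s decaying block means, and absorption at the maximum
# of the WEIGHTED modulus — § [NE7bP1-G121-HANDOFF] NEXT (3)(a), decay half (row NE7b, node U5c; (144)∕(148)∕(149)∕(151)∕(153) BY NAME;
# [folklore])

Cell `pub-balaban`, sub-cell `t4`, spine estimate NE7b (`T4WeightBudget.RelWeightBound`; the cell's OWN estimate — NOT PRINTED in
[Bałaban 1983–89], NOT PROVED).  Crux-route work under `Spine/NE7b/` by the row OWNER (`t4-ne7b-p1` gen 122, file (154)) under FREEZE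
(0)'s crux-prover clause; NOTHING of Bałaban's is named as a Lean object, valued or asserted; no `T4Continuum/Support` leaf typed; no `def`,
no notation (the action DISPLAYED exactly as in (133)–(153)); zero `sorry`.  Imports (BY NAME): the OWNER's (153) `…SupTorusBlockL1Profile`
(`blockL1_le_of_supProfile`, `near_dist_le`, `sum_cube_le_of_near`, `laplacian_site_le`; through it (151) `lap_lift`, `blk_near_of_mem_cube`,
(148) `exists_blockColumns`, (132) `isPseudoDist_torus`, (131) `exists_rate`, the torus dictionary), (149) `…SupTorusPointwiseProfile`
(`blockMean_le_of_supProfile`, road's class) and, through (151), the β-team's `Beta.PoissonInterior.interior_estimate` — the inhomogeneous interior estimate for the lattice Poisson equation on `ℤ^d`, `d ≥ 3`,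
`|u x| ≤ C(d)(m²·sup_{cube(3m)}|Δu| + m^{−d}Σ_{cube(3m)}|u|)`, [folklore], kernel-proved there from lit1's lattice Green function).

WHY (located).  (146)∕(147)∕(149) give pointwise DECAY on the strictly convex class `V ≥ v₀ > 0` through the maximum principle for
`L_V = (n+1)²(−Δ) + V` and the cosh comparison profile; on the road's class `V ≥ −λ` of either sign there is no comparison principle.
(152) replaced it by interior regularity for the sup NORM; the same mechanism localises: at the maximum `x₀` of the WEIGHTED modulus
`e^{δρ_s(bt x, y₀)}|u x|` (`S` its value), every quantity entering the interior estimate on the cube of radius `3m ≤ n+1` about a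
representative of `x₀` lives in blocks within `ρ_s`-distance `d` of `bt x₀` ((153) `near_dist_le`), so carries the factor
`e^{dδ}e^{−δρ_s(bt x₀, y₀)}`: the source (`γ ≥ δ`), the zeroth-order term (`(|λ| + Λ)·e^{−δρ}·S`), the block means ((149)), and the block-`ℓ¹`
norms ((153)); multiplying by the weight, `S ≤ C(d)e^{dδ}θ²(|λ| + Λ)S + K·M ≤ S∕4 + K·M` for `θ` with `C(d)e^{dδ}θ²(|λ| + Λ) ≤ 1∕4`, `θ ≤ 1∕3`.
Meshes with `θ(n+1) < 2` have `≤ (2∕θ)^d` sites per block and (153)'s letter is already pointwise.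

WHAT IS PROVED ([folklore]; fine torus `Site d ((n+1)s)`, coarse `Site d s`, `[NeZero s]`; the action DISPLAYED; `σ = siteOf`, `bt x =
σ_s(blk n (wm x))`, `ρ_s` the `ℓ¹` circular distance):
* §1 THE HEADLINE **`pointwise_decay_road`**: `d ≥ 3`, `a > 0`, `λ < min(2,a)`, `Λ ≥ 0`, `γ > 0` ⟹ `∃ C δ > 0` (functions of `(d, a, λ, Λ, γ)`
  and `C(d)`) such that for ALL `n, s`, ALL `−λ ≤ V ≤ Λ`, every block `y₀`, EVERY `f` with `|f x| ≤ M·e^{−γρ_s(bt x, y₀)}` (no support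
  condition) and every `Hu = f`: `e^{δρ_s(bt x, y₀)}·|u x| ≤ C·M` at EVERY site `x`.
* §2 toy (`d = 3`).

HONEST (what this is NOT).  `d ≥ 3` only (transience behind `interior_estimate`; `d = 4` is the cell's case); `C` inherits lit1's
existential Green-function constants; rates far from sharp (`δ = min(κ, γ∕2)`); cubic periods; scalar skeleton ((A3), NC-NE7b-α UNRULED);
nothing of the covariant propagators of [B4]–[B6]; nothing of Bałaban's.  BY-NAME EFFECT ON THE WALL: NONE.  NE7b NOT PRINTED ∕ NOT PROVED;
spine PROVED 0∕9; rung (B)+1 on a FINITE torus — NOT infinite volume, NOT the mass gap, NOT Clay.  HONEST DEPENDENCY: continuum YM on T⁴ ⇐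
BetaPertH ∧ nine spine estimates (0∕9 proved); BetaPertH ⇐ (D1) ∧ (D4) ∧ CAP+tail; G-an2-4 gates asym, D1 and NE2∕3∕4.
-/

set_option autoImplicit false

noncomputable section

namespace Summit.QuantumFields.BalabanUV.T4Continuum.NE7b.SupTorusPointwiseDecayRoad

open Real
open Literature.MathematicalPhysics.QuantumFieldTheory.Balaban1983to89
open Literature.Probability.LatticeModels (latticeLaplacianZd)
open B6QGQLower276 (X e blk B side chart mem_B sum_B sum_B_const card_cube blk_chart)
open Beta (Site siteOf windowMap siteOf_windowMap siteOf_add siteOf_sub)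
open Beta.PoissonInterior (cube mem_cube interior_estimate)
open SupTorusDirichletForm (siteOf_chart_surjective blockOf_siteOf_of_mem blockOf_siteOf)
open SupTorusDirichletFormCoercive (comp_siteOf_periodic)
open PeriodicSupTorusCarrier (exists_windowMap_siteOf)
open OneShotChartTorusRowsZd (sum_B_translate)
open SupTorusHessianCombesThomas (exists_rate)
open SupTorusBlockDistance (isPseudoDist_torus)
open SupTorusSupNormBound (exists_blockColumns)
open SupTorusPointwiseProfile (blockMean_le_of_supProfile)
open SupTorusBlockL1Letter (lap_lift blk_near_of_mem_cube)
open SupTorusBlockL1Profile (blockL1_le_of_supProfile near_dist_le sum_cube_le_of_near laplacian_site_le)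

variable {d : ℕ}

/-! ## §1. THE END: pointwise exponential decay on the road's class, every mesh, every volume -/

set_option maxHeartbeats 400000 in
/-- **HEADLINE — `|f| ≤ M·e^{−γρ_s(bt ·, y₀)}` ⟹ `e^{δρ_s(bt x, y₀)}·|H_V⁻¹f|(x) ≤ C·M` AT EVERY SITE, ON THE ROAD'S OWN CLASS `−λ ≤ V ≤ Λ`
(EITHER SIGN), `d ≥ 3`, every mesh, every volume** — `(C, δ)` functions of `(d, a, λ, Λ, γ)` and the interior constant `C(d)` only; EVERY source
with that profile (no support condition; a source supported in the block `y₀` with `|f| ≤ M` is the case `γ` arbitrary).  Interior regularity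
on the periodic lift at the radius `3m`, `m = ⌊θ(n+1)⌋`, about a representative of the maximum `x₀` of the weighted modulus; every block met
is within `ρ_s`-distance `d` of `bt x₀` (§2), so the source, the zeroth-order term, the block means ((149)) and the block-`ℓ¹` norms (§1)
all carry `e^{dδ}e^{−δρ_s(bt x₀, y₀)}`; `θ` is chosen with `C(d)e^{d}θ²(|λ| + Λ) ≤ 1∕4` and the zeroth-order term is absorbed; meshes with
`θ(n+1) < 2` are read off §1 directly.  § [NE7bP1-G121-HANDOFF] NEXT (3)(a), decay half, with NO hypothesis left. [folklore] -/
theorem pointwise_decay_road (hd : 3 ≤ d) (a : ℝ) (ha : 0 < a) {lam Lam γ : ℝ} (hlam : lam < min 2 a) (hLam : 0 ≤ Lam) (hγ : 0 < γ) :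
    ∃ C δ : ℝ, 0 < C ∧ 0 < δ ∧ ∀ (n s : ℕ) [NeZero s] (V : Site d ((n + 1) * s) → ℝ), (∀ x, -lam ≤ V x) → (∀ x, V x ≤ Lam) →
      ∀ (y₀ : Site d s) (M : ℝ) (u f : Site d ((n + 1) * s) → ℝ),
      (∀ x, |f x| ≤ M * exp (-(γ * ∑ i, ((((siteOf d s (blk n (windowMap d ((n + 1) * s) x))) i - y₀ i).valMinAbs.natAbs : ℕ) : ℝ)))) →
      (∀ x, ((n : ℝ) + 1) ^ 2 * ∑ μ, (2 * u x - u (x + siteOf d ((n + 1) * s) (e μ)) - u (x - siteOf d ((n + 1) * s) (e μ)))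
        + a / ((n : ℝ) + 1) ^ d * ∑ q ∈ B n (blk n (windowMap d ((n + 1) * s) x)), u (siteOf d ((n + 1) * s) q) + V x * u x = f x) →
      ∀ x : Site d ((n + 1) * s),
        exp (δ * ∑ i, ((((siteOf d s (blk n (windowMap d ((n + 1) * s) x))) i - y₀ i).valMinAbs.natAbs : ℕ) : ℝ)) * |u x| ≤ C * M := by
  classical
  have hdR : (0 : ℝ) ≤ d := Nat.cast_nonneg d
  have hm0 : 0 < min 2 a - lam := by linarith
  obtain ⟨κ, hκ0, hκ1, hκm⟩ := exists_rate (d := d) a ha.le hm0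
  have hm : 0 < min 2 a - lam - 2 * d * κ ^ 2 - a * (exp (2 * d * κ) - 1) := by linarith
  set m := min 2 a - lam - 2 * d * κ ^ 2 - a * (exp (2 * d * κ) - 1) with hm_def
  have hminv : 0 ≤ m⁻¹ := inv_nonneg.2 hm.le
  -- the rate `δ = min(κ, γ∕2)` and the constants
  set δ : ℝ := min κ (γ / 2) with hδ_def
  have hδ0 : 0 < δ := lt_min hκ0 (by linarith)
  have hδκ : δ ≤ κ := min_le_left _ _
  have h2δ : 2 * δ ≤ γ := by have := min_le_right κ (γ / 2); rw [← hδ_def] at this; linarith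
  have hδγ : δ ≤ γ := by linarith
  have hδ1 : δ ≤ 1 := hδκ.trans hκ1
  set K : ℝ := (2 * (1 - exp (-δ))⁻¹) ^ d with hK
  have hK0 : 0 ≤ K := pow_nonneg (mul_nonneg zero_le_two (inv_nonneg.2 (sub_nonneg.2 (exp_le_one_iff.2 (by linarith))))) d
  set Cd : ℝ := m⁻¹ * exp (2 * d * κ) * K with hCd
  have hCd0 : 0 ≤ Cd := by positivity
  set E : ℝ := exp (d * δ) with hE
  have hE1 : 1 ≤ E := one_le_exp (by positivity)
  obtain ⟨CI, hCI0, hI⟩ := interior_estimate hd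
  set L : ℝ := |lam| + Lam with hL
  have hL0 : 0 ≤ L := by positivity
  set θ : ℝ := min (1 / 3) (1 / (4 * (CI * L * E + 1))) with hθ
  have hθ0 : 0 < θ := lt_min (by norm_num) (by positivity)
  have hθ3 : θ ≤ 1 / 3 := min_le_left _ _
  have hθabs : CI * L * E * θ ^ 2 ≤ 1 / 4 := by
    have h1 : θ ≤ 1 / (4 * (CI * L * E + 1)) := min_le_right _ _
    have h2 : θ ^ 2 ≤ θ * (1 / (4 * (CI * L * E + 1))) := by rw [sq]; exact mul_le_mul_of_nonneg_left h1 hθ0.le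
    have h3 : CI * L * E * (θ * (1 / (4 * (CI * L * E + 1)))) = θ / 4 * (CI * L * E / (CI * L * E + 1)) := by field_simp
    have h4 : CI * L * E / (CI * L * E + 1) ≤ 1 := by rw [div_le_one (by positivity)]; linarith
    calc CI * L * E * θ ^ 2 ≤ CI * L * E * (θ * (1 / (4 * (CI * L * E + 1)))) := mul_le_mul_of_nonneg_left h2 (by positivity)
      _ = θ / 4 * (CI * L * E / (CI * L * E + 1)) := h3
      _ ≤ θ / 4 * 1 := mul_le_mul_of_nonneg_left h4 (by positivity)
      _ ≤ 1 / 4 := by linarith [hθ3]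
  set K₁ : ℝ := (2 / θ) ^ d * Cd with hK₁
  set K₂ : ℝ := 2 * (CI * E) * (θ ^ 2 * (1 + a * Cd) + 3 ^ d * Cd * (2 / θ) ^ d) with hK₂
  have hK₁0 : 0 ≤ K₁ := by positivity
  have hK₂0 : 0 ≤ K₂ := by positivity
  refine ⟨max K₁ K₂ + 1, δ, by positivity, hδ0, ?_⟩
  intro n s _ V hV hV' y₀ M u f hf hu x
  have hP := isPseudoDist_torus (d := d) s
  have hM : 0 ≤ M := by
    have h1 := (abs_nonneg _).trans (hf x)
    exact le_of_mul_le_mul_right (by rw [zero_mul]; exact h1) (exp_pos _)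
  have hn1 : (0 : ℝ) < (n : ℝ) + 1 := by positivity
  have hvol : (0 : ℝ) < ((n : ℝ) + 1) ^ d := by positivity
  have hVabs : ∀ x', |V x'| ≤ L := fun x' => by
    rw [hL, abs_le]; constructor <;> linarith [hV x', hV' x', le_abs_self lam, neg_abs_le lam]
  -- block means and block `ℓ¹` norms carry the profile `e^{−δρ_s(·, y₀)}`
  obtain ⟨ψ, hψ⟩ := exists_blockColumns n a s ha.le hm0 V hV
  have hmean : ∀ y : Site d s, |(((n : ℝ) + 1) ^ d)⁻¹ * ∑ z : Fin d → Fin (n + 1), u (siteOf d ((n + 1) * s) (chart n (windowMap d s y) z))|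
      ≤ Cd * M * exp (-(δ * ∑ i, (((y i - y₀ i).valMinAbs.natAbs : ℕ) : ℝ))) := fun y => by
    have h := blockMean_le_of_supProfile n a s ha.le hκ0 hκ1 hm hδ0 hδκ h2δ V hV ψ hψ y₀ u f hf hu y
    rw [hCd]; linarith [h]
  have hL1 : ∀ b : X d, ∑ q ∈ B n b, |u (siteOf d ((n + 1) * s) q)|
      ≤ ((n : ℝ) + 1) ^ d * Cd * M * exp (-(δ * ∑ i, ((((siteOf d s b) i - y₀ i).valMinAbs.natAbs : ℕ) : ℝ))) := fun b => by
    have h := blockL1_le_of_supProfile n a s ha.le hκ0 hκ1 hm hδ0 hδκ h2δ V hV y₀ u f hf hu (siteOf d s b)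
    obtain ⟨t, ht⟩ := exists_windowMap_siteOf s b
    rw [← sum_B (windowMap d s (siteOf d s b)) (fun q => |u (siteOf d ((n + 1) * s) q)|), ht, sum_B_translate] at h
    simp only [comp_siteOf_periodic] at h
    rw [hCd]; linarith [h]
  -- the maximum of the weighted modulus
  obtain ⟨x₀, hx₀⟩ := Finite.exists_max fun x' : Site d ((n + 1) * s) =>
    exp (δ * ∑ i, ((((siteOf d s (blk n (windowMap d ((n + 1) * s) x'))) i - y₀ i).valMinAbs.natAbs : ℕ) : ℝ)) * |u x'|
  set ρ₀ : ℝ := ∑ i, ((((siteOf d s (blk n (windowMap d ((n + 1) * s) x₀))) i - y₀ i).valMinAbs.natAbs : ℕ) : ℝ) with hρ₀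
  set S : ℝ := exp (δ * ρ₀) * |u x₀| with hS_def
  have hS0 : 0 ≤ S := by positivity
  have hSx : ∀ x', |u x'| ≤ exp (-(δ * ∑ i, ((((siteOf d s (blk n (windowMap d ((n + 1) * s) x'))) i - y₀ i).valMinAbs.natAbs : ℕ) : ℝ)))
      * S := fun x' => by
    have h := hx₀ x'
    rw [exp_neg, ← div_eq_inv_mul, le_div_iff₀ (exp_pos _), mul_comm]
    exact h
  suffices hmain : S ≤ max K₁ K₂ * M by
    calc _ ≤ S := hx₀ x
      _ ≤ max K₁ K₂ * M := hmain
      _ ≤ (max K₁ K₂ + 1) * M := by rw [add_mul, one_mul]; linarith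
  -- the block of `x₀` through the chart
  obtain ⟨⟨y, z⟩, hyz⟩ := siteOf_chart_surjective n s x₀
  simp only at hyz
  have hbt : siteOf d s (blk n (windowMap d ((n + 1) * s) x₀)) = y := by
    rw [← hyz]; exact blockOf_siteOf_of_mem n s (mem_B.2 (blk_chart n (windowMap d s y) z))
  have hρ₀y : ρ₀ = ∑ i, (((y i - y₀ i).valMinAbs.natAbs : ℕ) : ℝ) := by rw [hρ₀, hbt]
  by_cases hsmall : θ * ((n : ℝ) + 1) < 2
  · -- small meshes
    have h1 : |u x₀| ≤ ∑ z' : Fin d → Fin (n + 1), |u (siteOf d ((n + 1) * s) (chart n (windowMap d s y) z'))| := by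
      rw [← hyz]
      exact Finset.single_le_sum (f := fun z' => |u (siteOf d ((n + 1) * s) (chart n (windowMap d s y) z'))|)
        (fun _ _ => abs_nonneg _) (Finset.mem_univ z)
    have h2 := blockL1_le_of_supProfile n a s ha.le hκ0 hκ1 hm hδ0 hδκ h2δ V hV y₀ u f hf hu y
    have h3 : ((n : ℝ) + 1) ^ d ≤ (2 / θ) ^ d := by
      refine pow_le_pow_left₀ hn1.le ?_ d
      rw [le_div_iff₀ hθ0]; linarith
    have h4 : exp (δ * ρ₀) * exp (-(δ * ∑ i, (((y i - y₀ i).valMinAbs.natAbs : ℕ) : ℝ))) = 1 := by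
      rw [← exp_add, hρ₀y, add_neg_cancel, exp_zero]
    calc S = exp (δ * ρ₀) * |u x₀| := rfl
      _ ≤ exp (δ * ρ₀) * (((n : ℝ) + 1) ^ d * (m⁻¹ * exp (2 * d * κ)) * M * K
          * exp (-(δ * ∑ i, (((y i - y₀ i).valMinAbs.natAbs : ℕ) : ℝ)))) :=
          mul_le_mul_of_nonneg_left (h1.trans h2) (exp_pos _).le
      _ = ((n : ℝ) + 1) ^ d * Cd * M * (exp (δ * ρ₀) * exp (-(δ * ∑ i, (((y i - y₀ i).valMinAbs.natAbs : ℕ) : ℝ)))) := by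
          rw [hCd]; ring
      _ = ((n : ℝ) + 1) ^ d * Cd * M := by rw [h4, mul_one]
      _ ≤ (2 / θ) ^ d * Cd * M := mul_le_mul_of_nonneg_right (mul_le_mul_of_nonneg_right h3 hCd0) hM
      _ = K₁ * M := by rw [hK₁]
      _ ≤ max K₁ K₂ * M := mul_le_mul_of_nonneg_right (le_max_left _ _) hM
  · -- large meshes: interior regularity with exponential weights
    have hsmall' : 2 ≤ θ * ((n : ℝ) + 1) := not_lt.1 hsmall
    set mm : ℕ := ⌊θ * ((n : ℝ) + 1)⌋₊ with hmm
    have hmm_le : (mm : ℝ) ≤ θ * ((n : ℝ) + 1) := Nat.floor_le (by positivity)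
    have hmm_ge : θ * ((n : ℝ) + 1) / 2 ≤ mm := by
      have := Nat.lt_floor_add_one (θ * ((n : ℝ) + 1))
      rw [← hmm] at this
      linarith
    have hmm2 : 2 ≤ mm := Nat.le_floor (by exact_mod_cast hsmall')
    have hmm1 : 1 ≤ mm := le_trans (by norm_num) hmm2
    have hmmR : (0 : ℝ) < mm := by exact_mod_cast (lt_of_lt_of_le zero_lt_one hmm1)
    have h3m : 3 * mm ≤ n + 1 := by
      have h : ((3 * mm : ℕ) : ℝ) ≤ ((n + 1 : ℕ) : ℝ) := by
        push_cast
        have := mul_le_mul_of_nonneg_right hθ3 hn1.le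
        linarith
      exact_mod_cast h
    set q₀ : X d := windowMap d ((n + 1) * s) x₀ with hq₀
    have hy0 : siteOf d s (blk n q₀) = y := hbt
    -- every near block is within `ρ_s`-distance `d` of `y`: its profile factor is `≤ e^{dδ}e^{−δρ₀}`
    have hnear : ∀ b : X d, (∀ i, blk n q₀ i - 1 ≤ b i ∧ b i ≤ blk n q₀ i + 1) →
        exp (-(δ * ∑ i, ((((siteOf d s b) i - y₀ i).valMinAbs.natAbs : ℕ) : ℝ))) ≤ E * exp (-(δ * ρ₀)) := fun b hb => by
      have hdist : ∑ i, ((((siteOf d s b) i - (siteOf d s (blk n q₀)) i).valMinAbs.natAbs : ℕ) : ℝ) ≤ d := near_dist_le s hb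
      rw [hy0] at hdist
      have htri : ∑ i, (((y i - y₀ i).valMinAbs.natAbs : ℕ) : ℝ)
          ≤ ∑ i, (((y i - (siteOf d s b) i).valMinAbs.natAbs : ℕ) : ℝ) + ∑ i, ((((siteOf d s b) i - y₀ i).valMinAbs.natAbs : ℕ) : ℝ) :=
        hP.triangle y (siteOf d s b) y₀
      have hsymm : ∑ i, (((y i - (siteOf d s b) i).valMinAbs.natAbs : ℕ) : ℝ) = ∑ i, ((((siteOf d s b) i - y i).valMinAbs.natAbs : ℕ) : ℝ) :=
        hP.symm y (siteOf d s b)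
      rw [hE, ← exp_add, hρ₀y]
      refine exp_le_exp.2 ?_
      rw [hsymm] at htri
      have k1 := mul_le_mul_of_nonneg_left htri hδ0.le
      have k2 := mul_le_mul_of_nonneg_left hdist hδ0.le
      linarith
    obtain ⟨A, hA⟩ : ∃ A : ℝ, A = E * exp (-(δ * ρ₀)) * (M + L * S + a * (Cd * M)) / ((n : ℝ) + 1) ^ 2 := ⟨_, rfl⟩
    obtain ⟨Bsum, hB⟩ : ∃ Bsum : ℝ, Bsum = 3 ^ d * (((n : ℝ) + 1) ^ d * Cd * M * (E * exp (-(δ * ρ₀)))) := ⟨_, rfl⟩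
    have hlap : ∀ p ∈ cube q₀ (3 * mm), |latticeLaplacianZd (fun p' : X d => u (siteOf d ((n + 1) * s) p')) p| ≤ A := by
      intro p hp
      rw [lap_lift, abs_neg]
      obtain ⟨⟨y', z'⟩, hyz'⟩ := siteOf_chart_surjective n s (siteOf d ((n + 1) * s) p)
      simp only at hyz'
      have hbt' : siteOf d s (blk n (windowMap d ((n + 1) * s) (siteOf d ((n + 1) * s) p))) = y' := by
        rw [← hyz']; exact blockOf_siteOf_of_mem n s (mem_B.2 (blk_chart n (windowMap d s y') z'))
      have hy'b : y' = siteOf d s (blk n p) := by rw [← hbt', blockOf_siteOf]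
      have hw : exp (-(δ * ∑ i, (((y' i - y₀ i).valMinAbs.natAbs : ℕ) : ℝ))) ≤ E * exp (-(δ * ρ₀)) := by
        rw [hy'b]; exact hnear (blk n p) (blk_near_of_mem_cube h3m hp)
      have hfx := hf (siteOf d ((n + 1) * s) p)
      have hux := hSx (siteOf d ((n + 1) * s) p)
      rw [hbt'] at hfx hux
      rw [← hyz'] at hfx hux ⊢
      have hρ' : 0 ≤ ∑ i, (((y' i - y₀ i).valMinAbs.natAbs : ℕ) : ℝ) := Finset.sum_nonneg fun _ _ => Nat.cast_nonneg _
      have hγδ : exp (-(γ * ∑ i, (((y' i - y₀ i).valMinAbs.natAbs : ℕ) : ℝ))) ≤ exp (-(δ * ∑ i, (((y' i - y₀ i).valMinAbs.natAbs : ℕ) : ℝ))) := by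
        refine exp_le_exp.2 ?_
        have := mul_le_mul_of_nonneg_right hδγ hρ'
        linarith
      have k1 : |f (siteOf d ((n + 1) * s) (chart n (windowMap d s y') z'))| ≤ M * (E * exp (-(δ * ρ₀))) :=
        hfx.trans ((mul_le_mul_of_nonneg_left hγδ hM).trans (mul_le_mul_of_nonneg_left hw hM))
      have k2 : |u (siteOf d ((n + 1) * s) (chart n (windowMap d s y') z'))| ≤ E * exp (-(δ * ρ₀)) * S :=
        hux.trans (mul_le_mul_of_nonneg_right hw hS0)
      have k3 : |(((n : ℝ) + 1) ^ d)⁻¹ * ∑ z : Fin d → Fin (n + 1), u (siteOf d ((n + 1) * s) (chart n (windowMap d s y') z))|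
          ≤ Cd * M * (E * exp (-(δ * ρ₀))) := (hmean y').trans (mul_le_mul_of_nonneg_left hw (by positivity))
      rw [hA]
      exact laplacian_site_le n a s ha.le hL0 V u f hu y' z' (hVabs _) k1 k2 k3
    have hl1 : ∑ p ∈ cube q₀ (3 * mm), |u (siteOf d ((n + 1) * s) p)| ≤ Bsum := by
      rw [hB]
      refine sum_cube_le_of_near h3m q₀ (F := fun p => |u (siteOf d ((n + 1) * s) p)|) (fun _ => abs_nonneg _) fun b hb => ?_
      exact (hL1 b).trans (mul_le_mul_of_nonneg_left (hnear b hb) (by positivity))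
    have hint0 := (hI mm hmm1 (fun p' : X d => u (siteOf d ((n + 1) * s) p')) q₀ A Bsum hlap hl1).1
    have e2 : siteOf d ((n + 1) * s) q₀ = x₀ := by rw [hq₀, siteOf_windowMap]
    have hint : |u x₀| ≤ CI * ((mm : ℝ) ^ 2 * A + Bsum / (mm : ℝ) ^ d) := by rw [← e2]; exact hint0
    have hX0 : 0 ≤ M + L * S + a * (Cd * M) := by positivity
    have hmA : (mm : ℝ) ^ 2 * A ≤ E * exp (-(δ * ρ₀)) * (θ ^ 2 * (M + L * S + a * (Cd * M))) := by
      have h1 : (mm : ℝ) ^ 2 ≤ θ ^ 2 * ((n : ℝ) + 1) ^ 2 := by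
        rw [← mul_pow]; exact pow_le_pow_left₀ hmmR.le hmm_le 2
      have h2 : (mm : ℝ) ^ 2 / ((n : ℝ) + 1) ^ 2 ≤ θ ^ 2 := by rwa [div_le_iff₀ (by positivity)]
      calc (mm : ℝ) ^ 2 * A = E * exp (-(δ * ρ₀)) * ((mm : ℝ) ^ 2 / ((n : ℝ) + 1) ^ 2 * (M + L * S + a * (Cd * M))) := by
            rw [hA]; ring
        _ ≤ _ := mul_le_mul_of_nonneg_left (mul_le_mul_of_nonneg_right h2 hX0) (by positivity)
    have hmB : Bsum / (mm : ℝ) ^ d ≤ E * exp (-(δ * ρ₀)) * (3 ^ d * Cd * (2 / θ) ^ d * M) := by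
      have hr : (n : ℝ) + 1 ≤ 2 / θ * mm := by
        rw [div_mul_eq_mul_div, le_div_iff₀ hθ0]; linarith
      have h1 : ((n : ℝ) + 1) ^ d ≤ (2 / θ) ^ d * (mm : ℝ) ^ d := by
        rw [← mul_pow]; exact pow_le_pow_left₀ hn1.le hr d
      have h2 : ((n : ℝ) + 1) ^ d / (mm : ℝ) ^ d ≤ (2 / θ) ^ d := by rwa [div_le_iff₀ (by positivity)]
      calc Bsum / (mm : ℝ) ^ d = E * exp (-(δ * ρ₀)) * (3 ^ d * Cd * M * (((n : ℝ) + 1) ^ d / (mm : ℝ) ^ d)) := by rw [hB]; ring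
        _ ≤ E * exp (-(δ * ρ₀)) * (3 ^ d * Cd * M * (2 / θ) ^ d) :=
            mul_le_mul_of_nonneg_left (mul_le_mul_of_nonneg_left h2 (by positivity)) (by positivity)
        _ = _ := by ring
    -- multiply by the weight and absorb
    have hw0 : exp (δ * ρ₀) * exp (-(δ * ρ₀)) = 1 := by rw [← exp_add, add_neg_cancel, exp_zero]
    have hS1 : S ≤ CI * E * (θ ^ 2 * (M + L * S + a * (Cd * M)) + 3 ^ d * Cd * (2 / θ) ^ d * M) := by
      have h := mul_le_mul_of_nonneg_left (hint.trans (mul_le_mul_of_nonneg_left (add_le_add hmA hmB) hCI0)) (exp_pos (δ * ρ₀)).le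
      have e : exp (δ * ρ₀) * (CI * (E * exp (-(δ * ρ₀)) * (θ ^ 2 * (M + L * S + a * (Cd * M)))
          + E * exp (-(δ * ρ₀)) * (3 ^ d * Cd * (2 / θ) ^ d * M)))
          = (exp (δ * ρ₀) * exp (-(δ * ρ₀))) * (CI * E * (θ ^ 2 * (M + L * S + a * (Cd * M)) + 3 ^ d * Cd * (2 / θ) ^ d * M)) := by
        ring
      rw [e, hw0, one_mul] at h
      exact h
    have hS2 : S ≤ (1 / 4) * S + (K₂ / 2) * M := by
      have e : CI * E * (θ ^ 2 * (M + L * S + a * (Cd * M)) + 3 ^ d * Cd * (2 / θ) ^ d * M)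
          = CI * L * E * θ ^ 2 * S + (K₂ / 2) * M := by rw [hK₂]; ring
      rw [e] at hS1
      have h4 := mul_le_mul_of_nonneg_right hθabs hS0
      linarith
    have hS3 : S ≤ K₂ * M := by
      have : 0 ≤ K₂ * M := by positivity
      linarith
    exact hS3.trans (mul_le_mul_of_nonneg_right (le_max_right _ _) hM)

/-! ## §2. Toy -/

/-- Toy (`d = 3`, `a = 1`, `λ = 0`, `Λ = 1`, `γ = 1`): the headline's hypotheses are inhabited, so the constants exist. -/
example : ∃ C δ : ℝ, 0 < C ∧ 0 < δ :=
  let ⟨C, δ, hC, hδ, _⟩ := pointwise_decay_road (d := 3) le_rfl 1 one_pos (lam := 0) (Lam := 1) (γ := 1)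
    (by rw [min_eq_right (by norm_num : (1 : ℝ) ≤ 2)]; norm_num) zero_le_one one_pos
  ⟨C, δ, hC, hδ⟩

end Summit.QuantumFields.BalabanUV.T4Continuum.NE7b.SupTorusPointwiseDecayRoad
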